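import Mathlib
import Summits.MatrixMultiplication.MatrixMultiplication.Theorems.SnSubsetDichotomyHyperoctahedralThresholdCleanPairDefs
import Summits.MatrixMultiplication.MatrixMultiplication.Theorems.SnSubsetDichotomyHyperoctahedralThresholdTypicalRoot
import Summits.MatrixMultiplication.MatrixMultiplication.Theorems.SnSubsetDichotomyHyperoctahedralThresholdCleanPairSepSum

/-!
# Clean-pair atom — a typical root for the separated family (ATOM_PROOF §2)

Helper for crux `SnSubsetDichotomy.HyperoctahedralThreshold` (stmt-MatrixMultiplication-10883), line
`Lines/stub_plan_poorRigidCore.md`.  `stub_typicalRootSep`: if `16(a+1)|F| + 16(a+1)²(3·2^(r+1))(Φ₀+1) ≤ n`, some root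
`v ≠ x` has at least `|RW a|/2` reduced words of length `a` that are `F`-avoiding AND `r`-separated from `(v, x)`.  Proof:
the abstract Markov step `TypicalRoot.exists_root` (landed with `stub_typicalRoot`, p128822) fed with the numerators
`stub_rootTypicalSum` (T1, `F`-hits) and `stub_separatedSum` (separatedness), plus `TypicalRoot.arith`.
-/

-- the tree's namespace `Summit.MatrixMultiplication.MatrixMultiplication.…` repeats a component by design
set_option linter.dupNamespace false

namespace Summit.MatrixMultiplication.MatrixMultiplication.Theorems.HyperoctahedralThreshold

namespace CleanPair.Typical

open Finset TwinSupplyCS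

variable {n : ℕ}

/-- For a word of length `a`, failing `Avoids` from the root `(v, x)` is failing the two-sided `F`-typicality clause of T1. -/
theorem not_avoids_iff (μ : Fin 3 → Equiv.Perm (Fin n)) (F : Finset (Fin n)) (v x : Fin n) {a : ℕ}
    {β : List (Fin 3)} (hβ : β.length = a) :
    ¬ CleanPair.Avoids μ F (fun σ => bif σ then x else v) β ↔
      ¬ (∀ t ≤ a, (β.take t).foldl (fun w d => μ d w) v ∉ F ∧ (β.take t).foldl (fun w d => μ d w) x ∉ F) := by
  rw [not_iff_not]
  constructor
  · intro h t ht
    exact ⟨h false t (by omega), h true t (by omega)⟩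
  · intro h σ t ht
    rw [hβ] at ht
    cases σ
    · exact (h t ht).1
    · exact (h t ht).2

end CleanPair.Typical

open Classical in
/-- **`stub_typicalRootSep`** (registered sub-goal of stmt-MatrixMultiplication-10883): a typical root for the family of
`F`-avoiding, `r`-separated strands (ATOM_PROOF §2). -/
theorem stub_typicalRootSep : ∀ (n a r Φ₀ : ℕ) (μ : Fin 3 → Equiv.Perm (Fin n)) (F : Finset (Fin n)), (∀ c, μ c * μ c = 1) → 1 ≤ a → 2 ≤ n → (∀ w : List (Fin 3), w ≠ [] → List.IsChain (· ≠ ·) w → w.length ≤ a + r → ((Finset.univ : Finset (Fin n)).filter (fun y => w.foldl (fun v b => μ b v) y = y)).card ≤ Φ₀) → 16 * (a + 1) * F.card + 16 * (a + 1) ^ 2 * (3 * 2 ^ (r + 1)) * (Φ₀ + 1) ≤ n → ∃ v x : Fin n, v ≠ x ∧ 3 * 2 ^ a ≤ 4 * ((Summit.MatrixMultiplication.MatrixMultiplication.Theorems.HyperoctahedralThreshold.TwinSupplyCS.RW a).filter (fun β => Summit.MatrixMultiplication.MatrixMultiplication.Theorems.HyperoctahedralThreshold.CleanPair.Avoids μ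 F (fun σ => bif σ then x else v) β ∧ Summit.MatrixMultiplication.MatrixMultiplication.Theorems.HyperoctahedralThreshold.CleanPair.Separated μ r (fun σ => bif σ then x else v) β)).card := by
  intro n a r Φ₀ μ F hμ ha hn hΦ₀ hbig
  have hW : (TwinSupplyCS.RW a).card = 3 * 2 ^ (a - 1) := TwinSupplyCS.card_RW ha
  have h2T : 2 * (3 * 2 ^ (a - 1)) = 3 * 2 ^ a := by
    have e : 2 ^ a = 2 ^ (a - 1) * 2 := by rw [← pow_succ, Nat.sub_add_cancel ha]
    rw [e]; ring
  have hWmem : ∀ β ∈ TwinSupplyCS.RW a, β ∈ TwinSupplyCS.RW a ∧ True := fun β hβ => ⟨hβ, trivial⟩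
  -- numerator A: F-hits (T1), transported to `RW a` and `Avoids`
  have hA : ∑ v : Fin n, ∑ x : Fin n, ((TwinSupplyCS.RW a).filter fun β => True ∧
      ¬ CleanPair.Avoids μ F (fun σ => bif σ then x else v) β).card ≤ 2 * (a + 1) * F.card * n * (3 * 2 ^ a) := by
    refine le_trans (le_of_eq ?_) (stub_rootTypicalSum n a μ F hμ)
    refine Finset.sum_congr rfl fun v _ => Finset.sum_congr rfl fun x _ => ?_
    rw [TwinSupplyCS.RW_eq_vector, Finset.filter_filter]
    congr 1
    refine Finset.filter_congr fun β hβ => ?_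
    have hlen : β.length = a := by
      obtain ⟨w, -, rfl⟩ := Finset.mem_image.1 hβ
      exact w.toList_length
    rw [true_and, CleanPair.Typical.not_avoids_iff μ F v x hlen]
  -- numerator B: separatedness
  have hB : ∑ v : Fin n, ∑ x : Fin n, ((TwinSupplyCS.RW a).filter fun β => True ∧
      ¬ CleanPair.Separated μ r (fun σ => bif σ then x else v) β).card ≤
      (a + 1) ^ 2 * n * (3 * 2 ^ a) * (2 * (3 * 2 ^ (r + 1)) * (Φ₀ + 1)) := by
    refine le_trans (le_of_eq ?_) ((stub_separatedSum n a r Φ₀ μ hμ hΦ₀).trans (le_of_eq (by ring)))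
    refine Finset.sum_congr rfl fun v _ => Finset.sum_congr rfl fun x _ => ?_
    congr 1
    exact Finset.filter_congr fun β _ => by rw [true_and]
  have harith : 4 * (2 * (a + 1) * F.card * n * (3 * 2 ^ a) +
      (a + 1) ^ 2 * n * (3 * 2 ^ a) * (2 * (3 * 2 ^ (r + 1)) * (Φ₀ + 1))) <
      n * ((n - 1) * (2 * (TwinSupplyCS.RW a).card + 1)) := by
    rw [hW, h2T]
    refine TypicalRoot.arith hn ?_
    calc 8 * (a + 1) * (2 * F.card + (a + 1) * (2 * (3 * 2 ^ (r + 1)) * (Φ₀ + 1)))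
        = 16 * (a + 1) * F.card + 16 * (a + 1) ^ 2 * (3 * 2 ^ (r + 1)) * (Φ₀ + 1) := by ring
      _ ≤ n := hbig
  obtain ⟨v, x, hvx, h⟩ := TypicalRoot.exists_root (TwinSupplyCS.RW a) (TwinSupplyCS.RW a) (fun _ => True)
    (fun v x β => CleanPair.Avoids μ F (fun σ => bif σ then x else v) β)
    (fun v x β => CleanPair.Separated μ r (fun σ => bif σ then x else v) β) hWmem hA hB harith
  refine ⟨v, x, hvx, ?_⟩
  rw [← h2T, ← hW]
  refine h.trans (Nat.mul_le_mul_left 4 (le_of_eq ?_))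
  congr 1
  exact Finset.filter_congr fun β _ => by rw [true_and]

end Summit.MatrixMultiplication.MatrixMultiplication.Theorems.HyperoctahedralThreshold
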